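import Literature.NumberTheory.LFunctions.PolynomialRootMoebiusEulerProduct
import Mathlib.NumberTheory.LSeries.Deriv
import Mathlib.NumberTheory.LSeries.RiemannZeta
import HarnessLib

/-!
# Landau's log-Riesz constant of `μρ_g` is the Bateman–Horn constant `C(![g])`

Topic `Literature/NumberTheory/LFunctions` (consumer of `PolynomialRootMoebiusRieszMean.lean`,
where the log-Riesz mean `Σ_{n ≤ x} μ(n)ρ_g(n)/n · log(x/n)` is shown to CONVERGE — to an
unnamed `L = L(h,1)/κ_K` — by Landau's prime ideal theorem, and of
`PolynomialRootMoebiusEulerProduct.lean`).  Everything here is PROVED.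

* `tendsto_logRieszMean_moebius_rootCount_batemanHornConst` — for a one-polynomial
  Bateman–Horn system `![g]`,
  **`Σ_{n ≤ x} μ(n)ρ_g(n)/n · log(x/n) → C(![g]) = ∏_p (1 − 1/p)⁻¹(1 − ρ_g(p)/p)`** (`x → ∞`),
  the tree's `batemanHornConst ![g]`; `…_nat` along `x = D ∈ ℕ`;
  `abs_logRieszMean_moebius_rootCount_sub_batemanHornConst_le` — the same with Landau's rate
  `O(exp(−c√log x))`.  For `g = X` this is `Σ_{n ≤ x} μ(n)/n · log(x/n) → 1` (Montgomery–Vaughan §6.2).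

This is the identification of the singular series of the linear sieve along the values of `g`
(the constant produced by the `M`-function / first-order Riesz mean of `μρ_g`) with the
Hardy–Littlewood–Bateman–Horn constant of `g`.

Proof.  Both constants are `lim_{s → 1⁺} L(μρ_g, s)·ζ(s)` (real `s`): (i) analytically,
`L(μρ_g, s)ζ_K(s) = L(h, s)` (`LSeries_moebiusRootCount_mul_dedekindZeta`) with `L(h, ·)`
absolutely convergent at `3/4`, hence continuous at `1`, `(s − 1)ζ_K(s) → κ_K` (Mathlib's class
number formula `NumberField.tendsto_sub_one_mul_dedekindZeta_nhdsGT`) and `(s − 1)ζ(s) → 1`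
(`tendsto_sub_mul_tsum_nat_rpow`), so the limit is `L(h,1)/κ_K`, which is the Riesz-mean limit of
the tool `NumberField.logRieszMean_LSeries_div_dedekindZeta_bound`; (ii) as an Euler product the
limit is `C(![g])` (`tendsto_moebiusRootCount_mul_zetaReal`).

## References

* E. Landau, Math. Ann. 56 (1903), 645–670, Part II (prime ideal theorem with error term; the
  analytic input, PROVED upstream). [cite: LandauMathAnn1903, Part II]
* P. T. Bateman, R. A. Horn, Math. Comp. 16 (1962), 363–367, §2 eq. (2) (the constant).
  [cite: BatemanHornMathComp1962, §2 eq. (2)]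
* H. L. Montgomery, R. C. Vaughan, *Multiplicative Number Theory I*, §6.2 (the case `g = X`).
  [cite: MontgomeryVaughan2007, §6.2]
-/

noncomputable section

open Filter Finset Nat ArithmeticFunction Polynomial Complex
open scoped Topology BigOperators ArithmeticFunction.Moebius

namespace Literature.NumberTheory.LFunctions

open Literature.NumberTheory.Sieve

/-! Local notation as in `PolynomialRootMoebiusEulerProduct.lean` (no new definitions). -/

/-- `a = μρ_g` as a complex arithmetic function (same local notation as upstream). -/
local notation "μρ[" g "]" => toArithmeticFunction (fun n : ℕ =>
  ((ArithmeticFunction.moebius n : ℤ) : ℂ) * ((Literature.NumberTheory.Sieve.polyRootCountMod ![g] n : ℕ) : ℂ))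

/-- `c_K` as a complex arithmetic function (zeroed at `0`). -/
local notation "cK[" K "]" => toArithmeticFunction (fun n : ℕ =>
  ((Literature.NumberTheory.LFunctions.idealNormCount K n : ℕ) : ℂ))

/-- `h = a ⋆ c_K`. -/
local notation "hE[" g ", " K "]" => ((μρ[g]) * (cK[K]) : ArithmeticFunction ℂ)

/-- The real Dirichlet series `F(s) = Σ_n μ(n)ρ_g(n) n^{-s}`. -/
local notation "Fℝ(" g ", " s ")" =>
  (∑' n : ℕ, (ArithmeticFunction.moebius n : ℝ) * (polyRootCountMod ![g] n : ℝ) * (n : ℝ) ^ (-(s : ℝ)))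

/-- The real zeta series `Σ_n n^{-s}`. -/
local notation "ζℝ(" s ")" => (∑' n : ℕ, (n : ℝ) ^ (-(s : ℝ)))

/-- B2': `(s − 1) Σ_n n^{-s} → 1` as `s → 1⁺` (Mathlib's `tendsto_sub_mul_tsum_nat_rpow`).
[folklore] -/
theorem tendsto_sub_one_mul_zetaReal :
    Tendsto (fun s : ℝ => (s - 1) * ζℝ(s)) (𝓝[>] 1) (𝓝 1) := by
  refine tendsto_sub_mul_tsum_nat_rpow.congr' (Eventually.of_forall fun s => ?_)
  congr 1
  refine tsum_congr fun n => ?_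
  rw [one_div, Real.rpow_neg (Nat.cast_nonneg _)]


/-! ## The complex side: `F(s) ζ(s) → H(1)/κ_K`, and the identification -/

section ComplexSide

variable {g : ℤ[X]} (hg : IsBatemanHornSystem ![g])
variable (K : Type*) [Field K] [NumberField K]

omit hg in
/-- The real series `F(s)` is the complex `L`-series `L(μρ_g, s)` at real points. [folklore] -/
theorem ofReal_moebiusRootCount_series (s : ℝ) :
    ((Fℝ(g, s) : ℝ) : ℂ) = LSeries (μρ[g]) (s : ℂ) := by
  rw [Complex.ofReal_tsum, LSeries]
  refine tsum_congr fun n => ?_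
  rcases eq_or_ne n 0 with rfl | hn
  · simp [LSeries.term_zero]
  · rw [LSeries.term_of_ne_zero hn, moebiusRootCount_apply]
    push_cast
    rw [Complex.ofReal_cpow (Nat.cast_nonneg n) (-s)]
    push_cast
    rw [Complex.cpow_neg, div_eq_mul_inv]

include hg in
/-- B4: **`F(s) ζ(s) → L(h, 1)/κ_K` as `s → 1⁺`** (complex), for a number field `K` whose
degree-one prime counts match `ρ_g` off finitely many primes: `L(μρ_g, s) ζ_K(s) = L(h, s)`
with `L(h, ·)` continuous at `1`, `(s − 1)ζ_K(s) → κ_K` (class number formula) and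
`(s − 1)ζ(s) → 1`. [folklore] -/
theorem tendsto_moebiusRootCount_mul_zetaReal_complex
    (hgood : ∃ e : ℕ, 0 < e ∧ ∀ p : ℕ, p.Prime → ¬ p ∣ e → hE[g, K] p = 0) :
    Tendsto (fun s : ℝ => ((Fℝ(g, s) * ζℝ(s) : ℝ) : ℂ)) (𝓝[>] 1)
      (𝓝 (LSeries (hE[g, K]) 1 / (NumberField.dedekindZeta_residue K : ℂ))) := by
  have hirr := bh_single_irreducible hg
  have hdeg : 0 < g.natDegree := by simpa using hg.natDegree_pos 0
  -- `s ↦ (s : ℂ)` along `s → 1⁺`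
  have h0 : Tendsto (fun s : ℝ => (s : ℂ)) (𝓝[>] 1) (𝓝 1) := by
    have := ((Complex.continuous_ofReal.tendsto (1 : ℝ)).mono_left
      (nhdsWithin_le_nhds (s := Set.Ioi (1 : ℝ))))
    simpa using this
  -- (ii) continuity of `L(h, ·)` at `1`
  obtain ⟨B, hhs, -⟩ := lseriesSummable_rootExcess K hirr hdeg hgood
  have habs : LSeries.abscissaOfAbsConv (hE[g, K]) < (1 : ℂ).re := by
    have h1 := hhs.abscissaOfAbsConv_le
    simp only [Complex.ofReal_re, Complex.one_re] at h1 ⊢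
    exact lt_of_le_of_lt h1 (by exact_mod_cast (by norm_num : (3 : ℝ) / 4 < 1))
  have hH : Tendsto (fun s : ℝ => LSeries (hE[g, K]) (s : ℂ)) (𝓝[>] 1)
      (𝓝 (LSeries (hE[g, K]) 1)) :=
    ((LSeries_hasDerivAt habs).continuousAt.tendsto).comp h0
  -- (iii) `(s - 1) ζ_K(s) → κ_K ≠ 0`
  have hκ : (NumberField.dedekindZeta_residue K : ℂ) ≠ 0 := by
    exact_mod_cast NumberField.dedekindZeta_residue_ne_zero K
  have hZ : Tendsto (fun s : ℝ => ((s : ℂ) - 1) * NumberField.dedekindZeta K (s : ℂ)) (𝓝[>] 1)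
      (𝓝 (NumberField.dedekindZeta_residue K : ℂ)) := by
    have := NumberField.tendsto_sub_one_mul_dedekindZeta_nhdsGT K
    refine this.congr' (Eventually.of_forall fun s => ?_)
    push_cast
    ring
  -- (iv) `F(s)/(s - 1) → L(h, 1)/κ_K`
  have hev : ∀ᶠ s : ℝ in 𝓝[>] 1, ((s : ℂ) - 1) * NumberField.dedekindZeta K (s : ℂ) ≠ 0 :=
    hZ.eventually_ne hκ
  have hF : Tendsto (fun s : ℝ => ((Fℝ(g, s) : ℝ) : ℂ) / ((s : ℂ) - 1)) (𝓝[>] 1)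
      (𝓝 (LSeries (hE[g, K]) 1 / (NumberField.dedekindZeta_residue K : ℂ))) := by
    refine (hH.div hZ hκ).congr' ?_
    filter_upwards [hev, self_mem_nhdsWithin] with s hne (hs : 1 < s)
    have hζ : NumberField.dedekindZeta K (s : ℂ) ≠ 0 := (mul_ne_zero_iff.mp hne).2
    have hre : 1 < (s : ℂ).re := by simpa using hs
    simp only [Pi.div_apply]
    rw [← LSeries_moebiusRootCount_mul_dedekindZeta K hirr hdeg hre,
      ← ofReal_moebiusRootCount_series]
    rw [mul_div_mul_right _ _ hζ]
  -- (v) `(s - 1) ζ(s) → 1`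
  have hz : Tendsto (fun s : ℝ => (((s - 1) * ζℝ(s) : ℝ) : ℂ)) (𝓝[>] 1) (𝓝 1) := by
    have := (tendsto_sub_one_mul_zetaReal).ofReal
    simpa using this
  have hmul := hF.mul hz
  rw [mul_one] at hmul
  refine hmul.congr' ?_
  filter_upwards [self_mem_nhdsWithin] with s (hs : 1 < s)
  have hs1 : (s : ℂ) - 1 ≠ 0 := by
    rw [sub_ne_zero]
    exact_mod_cast hs.ne'
  push_cast
  field_simp

end ComplexSide

/-! ## The theorem -/

/-- **Landau's log-Riesz constant of `μρ_g` is the Bateman–Horn constant.** For a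
one-polynomial Bateman–Horn system `![g]` (`g ∈ ℤ[X]` irreducible with positive leading
coefficient and no fixed prime divisor) and `ρ_g(n) = #{r mod n : g(r) ≡ 0 (mod n)}`,
`Σ_{n ≤ x} μ(n)ρ_g(n)/n · log(x/n) → C(![g]) = ∏_p (1 − 1/p)⁻¹(1 − ρ_g(p)/p)` as `x → ∞`
(the ordered Euler product `batemanHornConst ![g]`).  The limit exists by Landau's prime ideal
theorem (`abs_logRieszMean_moebius_rootCount_sub_le`, value `L(h,1)/κ_K`); it is identified
through `lim_{s → 1⁺} L(μρ_g, s)ζ(s)`, computed once analytically (`L(h,1)/κ_K`) and once as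
an Euler product (`C(![g])`, the Tauberian matching `PrimeSum.tendsto_sum_primesLE_div` of
`Σ_p (1 − ρ_g(p))p^{-s}` with the ordered sum).  For `g = X`: `Σ_{n ≤ x} μ(n)/n·log(x/n) → 1`.
[cite: BatemanHornMathComp1962, §2 (the constant C(f) and its Euler product)] -/
theorem tendsto_logRieszMean_moebius_rootCount_batemanHornConst {g : ℤ[X]}
    (hg : IsBatemanHornSystem ![g]) :
    Tendsto (fun x : ℝ => ∑ n ∈ Finset.Icc 1 ⌊x⌋₊,
      (ArithmeticFunction.moebius n : ℝ) * (polyRootCountMod ![g] n : ℝ) / n * Real.log (x / n))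
      atTop (𝓝 (batemanHornConst ![g])) := by
  have hirr := bh_single_irreducible hg
  have hdeg : 0 < g.natDegree := by simpa using hg.natDegree_pos 0
  haveI : Fact (Irreducible ((integralNormalization g).map (algebraMap ℤ ℚ))) :=
    ⟨DegreeOnePrimes.irreducible_map_rat (monic_integralNormalization hirr.ne_zero)
      (irreducible_integralNormalization hirr hdeg)⟩
  set K := AdjoinRoot ((integralNormalization g).map (algebraMap ℤ ℚ)) with hK
  have hgood := exists_rootExcess_prime_eq_zero hirr hdeg
  set Lam : ℂ := LSeries (hE[g, K]) 1 / (NumberField.dedekindZeta_residue K : ℂ) with hLam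
  -- `Lam = C(![g])`: two evaluations of `lim_{s → 1⁺} F(s) ζ(s)`
  have h1 := tendsto_moebiusRootCount_mul_zetaReal_complex hg K hgood
  have h2 : Tendsto (fun s : ℝ => ((Fℝ(g, s) * ζℝ(s) : ℝ) : ℂ)) (𝓝[>] 1)
      (𝓝 ((batemanHornConst ![g] : ℝ) : ℂ)) :=
    (tendsto_moebiusRootCount_mul_zetaReal hg).ofReal
  have hLamC : Lam = ((batemanHornConst ![g] : ℝ) : ℂ) := tendsto_nhds_unique h1 h2
  -- the complex Riesz mean tends to `Lam` (Landau, de la Vallée-Poussin rate)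
  obtain ⟨c, hc, C', -, htool⟩ :=
    NumberField.logRieszMean_LSeries_div_dedekindZeta_bound K (σₕ := 3 / 4) (by norm_num)
  obtain ⟨B, hhs, hhB⟩ := lseriesSummable_rootExcess K hirr hdeg hgood
  have hbound : ∀ x : ℝ, 1 ≤ x →
      ‖(∑ n ∈ Finset.Icc 1 ⌊x⌋₊, μρ[g] n / n * (Real.log (x / n) : ℂ)) - Lam‖ ≤
        C' * B * Real.exp (-c * Real.sqrt (Real.log x)) :=
    fun x hx => htool (μρ[g]) (hE[g, K]) B hhs hhB
      (fun σ hσ => lseriesSummable_moebiusRootCount hirr hdeg hσ)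
      (fun s hs => LSeries_moebiusRootCount_mul_dedekindZeta K hirr hdeg hs) x hx
  have hE0 : Tendsto (fun x : ℝ => C' * B * Real.exp (-c * Real.sqrt (Real.log x))) atTop
      (𝓝 0) := by
    have h3 : Tendsto (fun x : ℝ => -c * Real.sqrt (Real.log x)) atTop atBot := by
      have := (Real.tendsto_sqrt_atTop.comp Real.tendsto_log_atTop).const_mul_atTop_of_neg
        (neg_lt_zero.mpr hc)
      simpa using this
    simpa using (Real.tendsto_exp_atBot.comp h3).const_mul (C' * B)
  have hRC : Tendsto (fun x : ℝ => ∑ n ∈ Finset.Icc 1 ⌊x⌋₊, μρ[g] n / n * (Real.log (x / n) : ℂ))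
      atTop (𝓝 Lam) := by
    rw [tendsto_iff_norm_sub_tendsto_zero]
    refine squeeze_zero' (Eventually.of_forall fun x => norm_nonneg _) ?_ hE0
    filter_upwards [eventually_ge_atTop (1 : ℝ)] with x hx using hbound x hx
  rw [hLamC] at hRC
  have hRR : Tendsto (fun x : ℝ => (((∑ n ∈ Finset.Icc 1 ⌊x⌋₊,
      (ArithmeticFunction.moebius n : ℝ) * (polyRootCountMod ![g] n : ℝ) / n *
        Real.log (x / n) : ℝ)) : ℂ)) atTop (𝓝 ((batemanHornConst ![g] : ℝ) : ℂ)) := by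
    refine hRC.congr fun x => ?_
    exact logRieszSum_moebiusRootCount_eq_ofReal g x
  exact tendsto_ofReal_iff.mp hRR

/-- The same along the natural numbers `D → ∞` (`⌊D⌋₊ = D`).
[cite: BatemanHornMathComp1962, §2 (the constant C(f) and its Euler product)] -/
theorem tendsto_logRieszMean_moebius_rootCount_batemanHornConst_nat {g : ℤ[X]}
    (hg : IsBatemanHornSystem ![g]) :
    Tendsto (fun D : ℕ => ∑ n ∈ Finset.Icc 1 D,
      (ArithmeticFunction.moebius n : ℝ) * (polyRootCountMod ![g] n : ℝ) / n *
        Real.log ((D : ℝ) / n)) atTop (𝓝 (batemanHornConst ![g])) := by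
  have h := (tendsto_logRieszMean_moebius_rootCount_batemanHornConst hg).comp
    tendsto_natCast_atTop_atTop
  refine h.congr fun D => ?_
  simp only [Function.comp_apply, Nat.floor_natCast]


/-- **The same with Landau's de la Vallée-Poussin rate**: there are `c > 0` and `C` with
`|Σ_{n ≤ x} μ(n)ρ_g(n)/n · log(x/n) − C(![g])| ≤ C·exp(−c√(log x))` for all `x ≥ 1`
(`abs_logRieszMean_moebius_rootCount_sub_le` with its limit identified by
`tendsto_logRieszMean_moebius_rootCount_batemanHornConst`). [cite: LandauMathAnn1903, Part II] -/
theorem abs_logRieszMean_moebius_rootCount_sub_batemanHornConst_le {g : ℤ[X]}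
    (hg : IsBatemanHornSystem ![g]) :
    ∃ c : ℝ, 0 < c ∧ ∃ C : ℝ, ∀ x : ℝ, 1 ≤ x →
      |(∑ n ∈ Finset.Icc 1 ⌊x⌋₊, (ArithmeticFunction.moebius n : ℝ) *
          (polyRootCountMod ![g] n : ℝ) / n * Real.log (x / n)) - batemanHornConst ![g]| ≤
        C * Real.exp (-c * Real.sqrt (Real.log x)) := by
  obtain ⟨L, c, hc, C, H⟩ := abs_logRieszMean_moebius_rootCount_sub_le (bh_single_irreducible hg)
    (by simpa using hg.natDegree_pos 0)
  -- the rate forces the limit `L`, which is therefore `C(![g])`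
  have hE : Tendsto (fun x : ℝ => C * Real.exp (-c * Real.sqrt (Real.log x))) atTop (𝓝 0) := by
    have h1 : Tendsto (fun x : ℝ => -c * Real.sqrt (Real.log x)) atTop atBot := by
      have := (Real.tendsto_sqrt_atTop.comp Real.tendsto_log_atTop).const_mul_atTop_of_neg
        (neg_lt_zero.mpr hc)
      simpa using this
    simpa using (Real.tendsto_exp_atBot.comp h1).const_mul C
  have hL : Tendsto (fun x : ℝ => ∑ n ∈ Finset.Icc 1 ⌊x⌋₊, (ArithmeticFunction.moebius n : ℝ) *
      (polyRootCountMod ![g] n : ℝ) / n * Real.log (x / n)) atTop (𝓝 L) := by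
    rw [tendsto_iff_norm_sub_tendsto_zero]
    refine squeeze_zero' (Eventually.of_forall fun x => norm_nonneg _) ?_ hE
    filter_upwards [eventually_ge_atTop (1 : ℝ)] with x hx
    rw [Real.norm_eq_abs]
    exact H x hx
  have hLC : L = batemanHornConst ![g] :=
    tendsto_nhds_unique hL (tendsto_logRieszMean_moebius_rootCount_batemanHornConst hg)
  subst hLC
  exact ⟨c, hc, C, H⟩

end Literature.NumberTheory.LFunctions
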